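import Literature.Analysis.SegalBargmann.HermiteCoefficientBound
import HarnessLib

/-!
# Orthonormality of the Hermite functions on `EuclideanSpace ℝ σ` and the finite Parseval identity (Folland 1989, §1.7 (vii))

Topic `Analysis/SegalBargmann`; namespace `Literature.Analysis.SegalBargmann`.  Continuation of
`Literature.Analysis.SegalBargmann.HermiteCoefficientBound`.  The tree's orthonormality of the Hermite functions
(`FockHermiteL2.hermite_orthonormal`, Lebesgue measure on `σ → ℝ`) transported to the Schwartz functions
`h_α = hermiteSchwartz (herm α)` on `EuclideanSpace ℝ σ` and to the bilinear pairing `bpair` of `HermiteCoefficients`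
(the `h_α` are REAL, so the sesquilinear and the bilinear pairings agree on them):

* `conj_hermiteSchwartz_herm` — `h_α` is real-valued;
* `bpair_herm_herm : ⟨h_α, h_β⟩ = δ_{αβ}`, `hermiteCoeff_herm`, `hermiteCoeff_sum_smul_herm` (the coefficient functional
  recovers the coefficients of a finite Hermite combination);
* `integral_norm_sq_sum_smul_herm` — the FINITE PARSEVAL identity `∫ ‖Σ_{β∈S} c_β h_β‖² = Σ_{β∈S} ‖c_β‖²`.

Everything is proved from Mathlib and the imported tree files; no cited fact is used as a hypothesis.

## References

* G. B. Folland, *Harmonic Analysis in Phase Space*, Annals of Mathematics Studies 122, Princeton UP (1989), §1.7 (vii).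
  [cite: Folland1989, §1.7]

## Provenance

Written for the tree under the LEAN-IN-TREE rule (2026-08-18) by the pub-hodgecm formalisation cell (model-construction
sub-cell, seat mc-binder-2).
-/

set_option autoImplicit false

noncomputable section

open MvPolynomial Complex SchwartzMap MeasureTheory
open scoped BigOperators Real ComplexConjugate

namespace Literature.Analysis.SegalBargmann

variable {σ : Type*} [Fintype σ] [DecidableEq σ]

/-- **The Hermite functions are real-valued**: `conj (h_α x) = h_α x` (the symbol `herm α` has real coefficients,
`FockHermiteL2.map_conj_herm`). [folklore] -/
theorem conj_hermiteSchwartz_herm (α : σ →₀ ℕ) (x : EuclideanSpace ℝ σ) :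
    conj (hermiteSchwartz (herm α) x) = hermiteSchwartz (herm α) x := by
  rw [hermiteSchwartz_apply, conj_hermiteFun, map_conj_herm]

/-- **Orthonormality on `EuclideanSpace ℝ σ`, sesquilinear form**: `∫ h_α · conj h_β = δ_{αβ}`.
[cite: Folland1989, §1.7] -/
theorem integral_hermiteSchwartz_mul_conj (α β : σ →₀ ℕ) :
    ∫ x : EuclideanSpace ℝ σ, hermiteSchwartz (herm α) x * conj (hermiteSchwartz (herm β) x) =
      if α = β then 1 else 0 := by
  simp_rw [hermiteSchwartz_apply]
  rw [integral_euclidean_eq_integral_pi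
    (fun y => hermiteFun (herm α) y * conj (hermiteFun (herm β) y))]
  exact hermite_orthonormal α β

/-- **Orthonormality for the bilinear pairing**: `⟨h_α, h_β⟩ = ∫ h_α h_β = δ_{αβ}` (the `h_β` are real).
[cite: Folland1989, §1.7] -/
theorem bpair_herm_herm (α β : σ →₀ ℕ) :
    bpair (hermiteSchwartz (herm α)) (hermiteSchwartz (herm β)) = if α = β then 1 else 0 := by
  rw [bpair_apply, ← integral_hermiteSchwartz_mul_conj]
  refine integral_congr_ae (Filter.Eventually.of_forall fun x => ?_)
  show hermiteSchwartz (herm α) x * hermiteSchwartz (herm β) x =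
    hermiteSchwartz (herm α) x * conj (hermiteSchwartz (herm β) x)
  rw [conj_hermiteSchwartz_herm]

/-- **The coefficient functional on the Hermite functions**: `c_α(h_β) = δ_{αβ}`. [cite: Folland1989, §1.7] -/
theorem hermiteCoeff_herm (α β : σ →₀ ℕ) :
    hermiteCoeff α (hermiteSchwartz (herm β)) = if α = β then 1 else 0 :=
  bpair_herm_herm α β

/-- **The coefficient functional recovers the coefficients of a finite Hermite combination**:
`c_α(Σ_{β∈S} c_β h_β) = c_α` for `α ∈ S` (and `= 0` for `α ∉ S`). [folklore] -/
theorem hermiteCoeff_sum_smul_herm (S : Finset (σ →₀ ℕ)) (c : (σ →₀ ℕ) → ℂ) (α : σ →₀ ℕ) :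
    hermiteCoeff α (∑ β ∈ S, c β • hermiteSchwartz (herm β)) = if α ∈ S then c α else 0 := by
  rw [hermiteCoeff, bpair_sum_right]
  simp_rw [bpair_smul_right]
  have h : ∀ β ∈ S, c β * bpair (hermiteSchwartz (herm α)) (hermiteSchwartz (herm β)) =
      if α = β then c α else 0 := fun β _ => by
    rw [bpair_herm_herm]
    split_ifs with hαβ
    · rw [hαβ, mul_one]
    · rw [mul_zero]
  rw [Finset.sum_congr rfl h, Finset.sum_ite_eq]

/-- **Finite Parseval identity**: `∫ ‖Σ_{β∈S} c_β h_β(x)‖² dx = Σ_{β∈S} ‖c_β‖²`. [cite: Folland1989, §1.7] -/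
theorem integral_norm_sq_sum_smul_herm (S : Finset (σ →₀ ℕ)) (c : (σ →₀ ℕ) → ℂ) :
    ∫ x : EuclideanSpace ℝ σ, ‖(∑ β ∈ S, c β • hermiteSchwartz (herm β)) x‖ ^ 2 = ∑ β ∈ S, ‖c β‖ ^ 2 := by
  set F : 𝓢(EuclideanSpace ℝ σ, ℂ) := ∑ β ∈ S, c β • hermiteSchwartz (herm β) with hF
  -- the conjugate of `F` is the combination with conjugated coefficients (the `h_β` are real)
  set G : 𝓢(EuclideanSpace ℝ σ, ℂ) := ∑ β ∈ S, conj (c β) • hermiteSchwartz (herm β) with hG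
  have hconj : ∀ x, conj (F x) = G x := fun x => by
    rw [hF, hG, sum_apply, sum_apply, map_sum]
    refine Finset.sum_congr rfl fun β _ => ?_
    rw [smul_apply, smul_apply, smul_eq_mul, smul_eq_mul, map_mul, conj_hermiteSchwartz_herm]
  -- `∫ ‖F‖² = ⟨F, G⟩` as a complex number
  have hint : ((∫ x : EuclideanSpace ℝ σ, ‖F x‖ ^ 2 : ℝ) : ℂ) = bpair F G := by
    rw [bpair_apply, ← integral_complex_ofReal]
    refine integral_congr_ae (Filter.Eventually.of_forall fun x => ?_)
    show ((‖F x‖ ^ 2 : ℝ) : ℂ) = F x * G x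
    rw [← hconj, Complex.mul_conj, Complex.normSq_eq_norm_sq, Complex.ofReal_pow]
  -- expand `⟨F, G⟩` bilinearly and use orthonormality
  have hexp : bpair F G = ∑ β ∈ S, c β * conj (c β) := by
    rw [hF, hG, bpair_sum_left]
    refine Finset.sum_congr rfl fun β hβ => ?_
    rw [bpair_smul_left, bpair_sum_right]
    simp_rw [bpair_smul_right, bpair_herm_herm]
    have h : ∀ γ ∈ S, conj (c γ) * (if β = γ then (1 : ℂ) else 0) = if β = γ then conj (c β) else 0 :=
      fun γ _ => by split_ifs with h <;> simp [h]
    rw [Finset.sum_congr rfl h, Finset.sum_ite_eq, if_pos hβ]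
  have hreal : ((∑ β ∈ S, ‖c β‖ ^ 2 : ℝ) : ℂ) = ∑ β ∈ S, c β * conj (c β) := by
    push_cast
    refine Finset.sum_congr rfl fun β _ => ?_
    rw [Complex.mul_conj, Complex.normSq_eq_norm_sq, Complex.ofReal_pow]
  have h := hint.trans (hexp.trans hreal.symm)
  exact_mod_cast h

end Literature.Analysis.SegalBargmann

end
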